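import Summits.NavierStokesRegularity.NavierStokesRegularity.Theses.QuantisedSymmetry
import Summits.NavierStokesRegularity.NavierStokesRegularity.Theorems.QuantisedSymmetryPolyhedralTruncationBridge
import Summits.NavierStokesRegularity.NavierStokesRegularity.Theorems.SoloInformedClayDichotomy
import Summits.NavierStokesRegularity.NavierStokesRegularity.Theorems.QuantisedSymmetryPolyhedralDssProfileExistsDominatesBlowupProfile
import Summits.NavierStokesRegularity.NavierStokesRegularity.Theorems.DssFarFieldSlavingDssTruncationBridge
import HarnessLib

/-!
# Strategist sketch s19-g22 (census family `s`, independent) — crux `PolyhedralDssProfileExists`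
(stmt-NavierStokesRegularity-1404, route-NavierStokesRegularity-QuantisedSymmetry)

Kernel-checked backbone of `STRATEGY-CENSUS-s19.md` (gen 22). Nothing here is a new result: every theorem is a
one-line composition of LANDED tree theorems, recorded so that the census's summit-strength claims are checked
rather than asserted.

* `crux_decides`        : X ⊢ ¬ Clay (A)            — the route's own `closes` with its two other binders
                                                        discharged by landed proofs (stmt-11331, stmt-0153).
* `crux_gives_breakdownC`: X ⊢ Clay (C)              — via the landed dichotomy (A) ∨ (C).
* `crux_gives_noSymmetryWitness`, `crux_gives_hub`   — dropping EVERY polyhedral clause of X (the group `G`,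
                                                        det = 1, irreducibility, equivariance) leaves statements
                                                        (W2 = `∃ λ>1, ¬TypeIDSSLiouville λ`, W1 = hub crux stmt-0155)
                                                        that STILL decide the summit (`noSymmetryWitness_decides`,
                                                        `hub_decides`): the polyhedral clauses are inert on the
                                                        summit path.
* `TypeIAncientProfileExists` (W3) and `crux_gives_W3` — the first weakening that is NOT known to decide the
                                                        summit (no DSS ⇒ no truncation bridge in tree); it cannot
                                                        replace X in `closes`.
* `SymmetryLast₁/₂`, `symmetryLast_assembles`, `symmetryLast₁_decides` — the typed "symmetry-last" split: assembly
                                                        proved (modus ponens) but piece 1 alone decides the summit,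
                                                        so it fails the decomposition rule "no piece ↔ summit".
-/

set_option linter.dupNamespace false

namespace Summit.NavierStokesRegularity.NavierStokesRegularity.Cruxes.PolyhedralDssProfileExists.S19g22

open MeasureTheory
open Literature.Analysis.FluidPDE
open Summit.NavierStokesRegularity.NavierStokesRegularity

/-- The crux X = `PolyhedralDssProfileExists`, by name. -/
abbrev X : Prop := Theses.QuantisedSymmetry.PolyhedralDssProfileExists

/-- **X decides the summit (negative side).** The route's deciding theorem `closes` with its other two binders
discharged by the landed `quantisedSymmetry_polyhedralTruncationBridge_proof` (stmt-11331) and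
`ClayUniqueness_holds` (stmt-0153). -/
theorem crux_decides (hX : X) : ¬ _root_.NavierStokesRegularity :=
  Theses.QuantisedSymmetry.closes hX Theorems.quantisedSymmetry_polyhedralTruncationBridge_proof
    Theses.QuantisedSymmetry.ClayUniqueness_holds

/-- **X proves Clay (C)** (breakdown on `ℝ³`), through the landed dichotomy (A) ∨ (C). -/
theorem crux_gives_breakdownC (hX : X) : NavierStokesBreakdownR3 :=
  (Theorems.navierStokesRegularity_or_breakdownR3).resolve_left (crux_decides hX)

/-- W2: there is a factor `λ > 1` at which Tsai's Type-I `λ`-DSS Liouville statement fails — X with ALL polyhedral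
clauses deleted. -/
def NoSymmetryWitness : Prop := ∃ c : ℝ, 1 < c ∧ ¬ TypeIDSSLiouville c

/-- X ⟹ W2 (landed: `exists_not_typeIDSSLiouville_of_polyhedralDssProfileExists`). -/
theorem crux_gives_noSymmetryWitness (hX : X) : NoSymmetryWitness :=
  Theorems.PolyhedralDssProfileExists.PolyhedralCell.exists_not_typeIDSSLiouville_of_polyhedralDssProfileExists hX

/-- W2 ⟹ W1 (the hub crux stmt-0155, in its `DssFarFieldSlaving` copy; the `Blowup` copy is the same term). -/
theorem hub_of_noSymmetryWitness (h : NoSymmetryWitness) : Theses.DssFarFieldSlaving.BlowupTypeIDssProfile := by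
  obtain ⟨c, -, hc⟩ := h
  dsimp only [Theses.DssFarFieldSlaving.BlowupTypeIDssProfile]
  exact fun hL => hc (hL c).1

/-- The two copies of the hub crux are syntactically equal. -/
theorem hub_copies_agree :
    Theses.Blowup.BlowupTypeIDssProfile = Theses.DssFarFieldSlaving.BlowupTypeIDssProfile := rfl

/-- X ⟹ W1 (landed stub `stub_dominatesBlowupProfile`). -/
theorem crux_gives_hub (hX : X) : Theses.Blowup.BlowupTypeIDssProfile :=
  Theorems.PolyhedralDssProfileExists.PolyhedralCell.stub_dominatesBlowupProfile hX

/-- **W1 alone decides the summit**: route `DssFarFieldSlaving`'s `closes` with its bridge binder discharged by the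
landed `dssTruncationBridge_proof`. -/
theorem hub_decides (hP : Theses.DssFarFieldSlaving.BlowupTypeIDssProfile) : ¬ _root_.NavierStokesRegularity :=
  Theses.DssFarFieldSlaving.closes Theorems.dssTruncationBridge_proof hP

/-- **W2 alone decides the summit.** -/
theorem noSymmetryWitness_decides (h : NoSymmetryWitness) : ¬ _root_.NavierStokesRegularity :=
  hub_decides (hub_of_noSymmetryWitness h)

/-- The polyhedral clauses are inert on the summit path: X decides the summit already through W2/W1, without the
route's own polyhedral truncation bridge. -/
theorem crux_decides_via_hub (hX : X) : ¬ _root_.NavierStokesRegularity :=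
  noSymmetryWitness_decides (crux_gives_noSymmetryWitness hX)

/-- W3: a nontrivial ancient mild solution with measurable slices and Type-I space-time decay exists (no DSS, no
symmetry). The first weakening of X on the ladder that is NOT known (in tree or in print) to decide the summit. -/
def TypeIAncientProfileExists : Prop :=
  ∃ u : ℝ → EuclideanSpace ℝ (Fin 3) → EuclideanSpace ℝ (Fin 3),
    IsAncientMildSolution 1 u ∧ (∀ t < 0, AEStronglyMeasurable (u t) volume) ∧
      (∃ C₀ : ℝ, HasTypeIDecay C₀ u) ∧ ¬ (∀ t < 0, u t =ᵐ[volume] 0)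

/-- X ⟹ W3 (projection). -/
theorem crux_gives_W3 (hX : X) : TypeIAncientProfileExists := by
  obtain ⟨-, -, -, -, -, -, u, hanc, hmeas, -, hdec, -, hnt⟩ := hX
  exact ⟨u, hanc, hmeas, hdec, hnt⟩

/-- Symmetry-last split, piece 1: a Type-I DSS profile exists with no symmetry requirement (= W2). -/
def SymmetryLast₁ : Prop := NoSymmetryWitness

/-- Symmetry-last split, piece 2: symmetrisation — some Type-I DSS profile can be chosen polyhedrally equivariant.
(Open; no engine: equivariance is not a property one can impose on a given nonlinear profile.) -/
def SymmetryLast₂ : Prop := NoSymmetryWitness → X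

/-- The split assembles (modus ponens) … -/
theorem symmetryLast_assembles (h₁ : SymmetryLast₁) (h₂ : SymmetryLast₂) : X := h₂ h₁

/-- … but piece 1 on its own already decides the summit, so the split violates "no piece ↔ summit". -/
theorem symmetryLast₁_decides (h₁ : SymmetryLast₁) : ¬ _root_.NavierStokesRegularity :=
  noSymmetryWitness_decides h₁

end Summit.NavierStokesRegularity.NavierStokesRegularity.Cruxes.PolyhedralDssProfileExists.S19g22
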